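import Mathlib
import Summits.NavierStokesRegularity.NavierStokesRegularity.Theorems.EulerZoomLiouvillePowerGaugeEulerLiouvillePastTwistedTools
import HarnessLib

/-!
# RELATIVE EQUILIBRIA AND RELATIVE PERIODIC ORBITS MODULO `O(3)` ARE TRIVIAL
# (line `relative-equilibria`, stub R1 `stub_twistedClock`, by name; crux = stmt-NavierStokesRegularity-19832)

Route `EulerZoomLiouville` (NavierStokesRegularity); width seat ns-ezl-w6 g2 (LEAD ns-typeII-p2 g12; line `relative-equilibria` of ns-idea-11 g6, 2026-08-28).
Members of Seregin's power-gauged ancient Euler class (`ρ > 0`) whose past `τ < T₁ ≤ 0` is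
* TWISTED-STEADY, `u(τ) = Q_τ ∘ v ∘ Q_τ⁻¹` — ONE state conjugated along an ARBITRARY path of linear isometries (rigidly rotating / precessing steady
  states; `Twisted.ae_eq_zero_of_gauge_of_pastTwistedSteady`), or
* TWISTED-PERIODIC, `u(τ) = L ∘ u(τ − P) ∘ L⁻¹` — periodic up to ONE linear isometry (rotating waves; `Twisted.ae_eq_zero_of_gauge_of_pastTwistedPeriodic`),
vanish a.e. on the slab; BY NAME `Twisted.twistedClock_stratum : InClass ρ u p H c → (IsPastTwistedSteady u ∨ IsPastTwistedPeriodic u) → VanishesAE u`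
(bodies verbatim, every `ρ > 0`).  EQUATION-FREE, by slices (tools `…PastTwistedTools`): for a.e. `τ` the slice `H(τ)` is a weak derivative of `u(τ)`
(`FrameSteady.ae_hasWeakFDerivOn_slice_past`); conjugate slices have conjugate gradients (`Twisted.ae_eq_conj_of_hasWeakFDerivOn`), and the isometries fix
the origin, so the gauge slice masses `∫_{B_r}|H(τ)|²_F` are `τ`-CONSTANT (steady) / a.e. `P`-PERIODIC (periodic) below `T₁` (`Twisted.sliceMass_conj`);
the `E`-gauge `∫∫_{Q_a(0)}|H|²_F ≤ c a^{1−ρ}` then forces them to vanish (`(a² − |T₁|) m(a) ≤ c a^{1−ρ}`, resp. `n J ≤ c (nS)^{1−ρ}` by packing `n` period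
windows, applied at every `T' = T₁ − jP/2`), so `H = 0` a.e. below `T₁`, a.e. slice is a.e. constant with zero energy by the `A`-gauge, and a member quiescent
on a past sub-slab is trivial (`Twisted.ae_eq_zero_of_weakGradient_slices_zero`).  `Q ≡ 1` / `L = 1` are the LEAD's steady / time-periodic past strata.
WHAT THIS IS NOT: not NS, not E — a CLOSED-FORM stratum of the crux CLASS on the MODEL lattice (`--supports` stmt-19832); 19832 OPEN. [folklore]
-/

noncomputable section

set_option linter.dupNamespace false -- flat `Theorems/<Route><Decl>…` files share the crux namespace `Summit.<S>.<S>.…`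

open MeasureTheory Set Filter Topology Metric Function TopologicalSpace
open scoped ENNReal NNReal

namespace Summit.NavierStokesRegularity.NavierStokesRegularity.Theorems.PowerGaugeEulerLiouville

open Literature.Analysis Literature.Analysis.FunctionSpaces Literature.Analysis.FluidPDE

namespace Twisted

variable {u : ℝ → EuclideanSpace ℝ (Fin 3) → EuclideanSpace ℝ (Fin 3)}
  {H : ℝ → EuclideanSpace ℝ (Fin 3) → EuclideanSpace ℝ (Fin 3) →L[ℝ] EuclideanSpace ℝ (Fin 3)}
  {p : ℝ → EuclideanSpace ℝ (Fin 3) → ℝ} {ρ : ℝ} {c : ℝ≥0} {T₁ : ℝ}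

/-! ## (R1a) Relative equilibria: twisted-steady past members are trivial -/

/-- **TWISTED-STEADY PAST MEMBERS ARE TRIVIAL** (`ρ > 0`).  If `u(τ) = Q_τ ∘ v ∘ Q_τ⁻¹` for all `τ < T₁ ≤ 0`, ONE state `v` conjugated along an ARBITRARY path
of linear isometries `Q_τ`, then `u = 0` a.e. on the slab: two good slices are isometric conjugates, so `H(τ) = R_τ ∘ H(τ₀)(R_τ⁻¹·) ∘ R_τ⁻¹` a.e.
(`ae_eq_conj_of_hasWeakFDerivOn`) and the slice masses `∫_{B_a}|H(τ)|²_F = m(a)` do not depend on `τ` (`sliceMass_conj`); the `E`-gauge gives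
`(a² − |T₁|) m(a) ≤ c a^{1−ρ}`, so `m ≡ 0`, `H = 0` a.e. below `T₁`, and `ae_eq_zero_of_weakGradient_slices_zero` concludes. [folklore] -/
theorem ae_eq_zero_of_gauge_of_pastTwistedSteady (hρ : 0 < ρ)
    (hsw : IsSuitableWeakSolutionOn (slab (EuclideanSpace ℝ (Fin 3)) (Iio 0) isOpen_Iio) 0 0 u p)
    (hH : HasWeakSpatialGradientOn (slab (EuclideanSpace ℝ (Fin 3)) (Iio 0) isOpen_Iio) u H)
    (hc : ∀ a : ℝ, 0 < a → ENNReal.ofReal (a ^ (2 * ρ)) * cknA a (0 : ℝ × EuclideanSpace ℝ (Fin 3)) u +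
        ENNReal.ofReal (a ^ ρ) * cknE a (0 : ℝ × EuclideanSpace ℝ (Fin 3)) H +
        ENNReal.ofReal (a ^ (2 * ρ)) * cknD a (0 : ℝ × EuclideanSpace ℝ (Fin 3)) p ≤ (c : ℝ≥0∞))
    (hT₁ : T₁ ≤ 0) {v : EuclideanSpace ℝ (Fin 3) → EuclideanSpace ℝ (Fin 3)}
    {Q : ℝ → (EuclideanSpace ℝ (Fin 3) ≃ₗᵢ[ℝ] EuclideanSpace ℝ (Fin 3))}
    (hu : ∀ τ : ℝ, τ < T₁ → u τ = fun x => Q τ (v ((Q τ).symm x))) :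
    uncurry u =ᵐ[volume.restrict (Iio (0 : ℝ) ×ˢ (univ : Set (EuclideanSpace ℝ (Fin 3))))] 0 := by
  have hE : ∀ a : ℝ, 0 < a → ENNReal.ofReal (a ^ ρ) * cknE a (0 : ℝ × EuclideanSpace ℝ (Fin 3)) H ≤ (c : ℝ≥0∞) :=
    fun a ha => le_trans (le_trans le_add_self le_self_add) (hc a ha)
  set f : ℝ × EuclideanSpace ℝ (Fin 3) → ℝ≥0∞ := fun z => ENNReal.ofReal (frobeniusNormSq (H z.1 z.2)) with hf
  have hgood := FrameSteady.ae_hasWeakFDerivOn_slice_past hH hT₁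
  have hne : (ae (volume.restrict (Iio T₁))).NeBot := by
    rw [ae_neBot, Ne, Measure.restrict_eq_zero, Real.volume_Iio]; exact ENNReal.top_ne_zero
  obtain ⟨τ₀, hτ₀, hτ₀T⟩ := (hgood.and (ae_restrict_mem measurableSet_Iio)).exists
  set m : ℝ → ℝ≥0∞ := fun r => ∫⁻ y in ball (0 : EuclideanSpace ℝ (Fin 3)) r, ENNReal.ofReal (frobeniusNormSq (H τ₀ y)) with hm
  -- every good slice is an isometric conjugate of the slice `τ₀`
  have hrep : ∀ᵐ τ ∂(volume.restrict (Iio T₁)),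
      H τ =ᵐ[volume] fun x => ((((Q τ₀).symm.trans (Q τ)) : EuclideanSpace ℝ (Fin 3) →L[ℝ] EuclideanSpace ℝ (Fin 3)).comp ((H τ₀ (((Q τ₀).symm.trans (Q τ)).symm x)).comp ((((Q τ₀).symm.trans (Q τ))).symm : EuclideanSpace ℝ (Fin 3) →L[ℝ] EuclideanSpace ℝ (Fin 3)))) := by
    filter_upwards [hgood, ae_restrict_mem measurableSet_Iio] with τ hτ hτT
    refine ae_eq_conj_of_hasWeakFDerivOn _ hτ₀ hτ ?_
    rw [hu τ hτT, hu τ₀ hτ₀T]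
    funext x
    simp
  have hmass : ∀ᵐ τ ∂(volume.restrict (Iio T₁)), ∀ r : ℝ, ∫⁻ y in ball (0 : EuclideanSpace ℝ (Fin 3)) r, f (τ, y) = m r := by
    filter_upwards [hrep] with τ hτ
    intro r
    have e : ∫⁻ y in ball (0 : EuclideanSpace ℝ (Fin 3)) r, f (τ, y) = ∫⁻ y in ball (0 : EuclideanSpace ℝ (Fin 3)) r,
        ENNReal.ofReal (frobeniusNormSq ((((Q τ₀).symm.trans (Q τ)) : EuclideanSpace ℝ (Fin 3) →L[ℝ] EuclideanSpace ℝ (Fin 3)).comp ((H τ₀ (((Q τ₀).symm.trans (Q τ)).symm y)).comp ((((Q τ₀).symm.trans (Q τ))).symm : EuclideanSpace ℝ (Fin 3) →L[ℝ] EuclideanSpace ℝ (Fin 3))))) := by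
      refine lintegral_congr_ae (ae_restrict_of_ae ?_)
      filter_upwards [hτ] with y hy
      simp only [hf, hy]
    rw [e, sliceMass_conj]
  -- the `E`-gauge: `(a² + T₁) m(a) ≤ c a^{1−ρ}`
  have key : ∀ a : ℝ, 1 ≤ a → |T₁| ≤ a ^ 2 → ENNReal.ofReal (a ^ 2 + T₁) * m a ≤ ENNReal.ofReal ((c : ℝ) * a ^ (1 - ρ)) := by
    intro a ha1 haT
    have ha0 : 0 < a := by linarith
    have hwin : Ioo (-(a ^ 2)) T₁ ×ˢ ball (0 : EuclideanSpace ℝ (Fin 3)) a ⊆ Ioo (-(a ^ 2)) 0 ×ˢ ball (0 : EuclideanSpace ℝ (Fin 3)) a :=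
      Set.prod_mono (Ioo_subset_Ioo le_rfl hT₁) Subset.rfl
    have hgauge := TimePeriodic.setLIntegral_window_le_of_gaugeE (H := H) (T := a ^ 2) ha0 le_rfl le_rfl (hE a ha0)
    refine le_trans ?_ ((lintegral_mono_set hwin).trans hgauge)
    rw [setLIntegral_box_eq_iterate hH hT₁ a]
    have hsl : ∀ᵐ τ ∂(volume.restrict (Ioo (-(a ^ 2)) T₁)), m a = ∫⁻ y in ball (0 : EuclideanSpace ℝ (Fin 3)) a, f (τ, y) := by
      filter_upwards [ae_restrict_of_ae_restrict_of_subset (fun τ hτ => hτ.2 : Ioo (-(a ^ 2)) T₁ ⊆ Iio T₁) hmass] with τ hτ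
      exact (hτ a).symm
    calc ENNReal.ofReal (a ^ 2 + T₁) * m a = ∫⁻ _ in Ioo (-(a ^ 2)) T₁, m a := by
          rw [lintegral_const, Measure.restrict_apply_univ, Real.volume_Ioo, show T₁ - -(a ^ 2) = a ^ 2 + T₁ by ring, mul_comm]
      _ = ∫⁻ τ in Ioo (-(a ^ 2)) T₁, ∫⁻ y in ball (0 : EuclideanSpace ℝ (Fin 3)) a, f (τ, y) := lintegral_congr_ae hsl
      _ ≤ _ := le_rfl
  -- hence `m ≡ 0`
  have hm0 : ∀ n : ℕ, m n = 0 := by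
    intro n
    have hbd : ∀ᶠ k : ℕ in atTop, m n ≤ ENNReal.ofReal (2 * (c : ℝ) * (k : ℝ) ^ (-1 - ρ)) := by
      filter_upwards [eventually_ge_atTop (max (max n 1) (Nat.ceil (Real.sqrt (2 * |T₁| + 2))))] with k hk
      have hk1 : (1 : ℝ) ≤ k := by exact_mod_cast (le_max_right _ _).trans ((le_max_left _ _).trans hk)
      have hkn : (n : ℝ) ≤ k := by exact_mod_cast (le_max_left _ _).trans ((le_max_left _ _).trans hk)
      have hk0 : (0 : ℝ) < k := by linarith
      have hkT : 2 * |T₁| + 2 ≤ (k : ℝ) ^ 2 := by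
        have h1 : Real.sqrt (2 * |T₁| + 2) ≤ k := (Nat.le_ceil _).trans (by exact_mod_cast (le_max_right _ _).trans hk)
        have h2 := Real.sq_sqrt (by positivity : (0 : ℝ) ≤ 2 * |T₁| + 2)
        nlinarith [Real.sqrt_nonneg (2 * |T₁| + 2)]
      have h1 := key k hk1 (by linarith [abs_nonneg T₁])
      have h2 : m n ≤ m k := lintegral_mono_set (ball_subset_ball hkn)
      have hpos : 0 < (k : ℝ) ^ 2 + T₁ := by linarith [neg_abs_le T₁, abs_nonneg T₁]
      have h3 : m k ≤ ENNReal.ofReal ((c : ℝ) * (k : ℝ) ^ (1 - ρ)) / ENNReal.ofReal ((k : ℝ) ^ 2 + T₁) := by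
        rw [ENNReal.le_div_iff_mul_le (Or.inl (ENNReal.ofReal_pos.2 hpos).ne') (Or.inl ENNReal.ofReal_ne_top), mul_comm]
        exact h1
      refine h2.trans (h3.trans ?_)
      rw [← ENNReal.ofReal_div_of_pos hpos]
      refine ENNReal.ofReal_le_ofReal ?_
      rw [div_le_iff₀ hpos]
      have h4 : (k : ℝ) ^ (1 - ρ) = (k : ℝ) ^ (-1 - ρ) * (k : ℝ) ^ 2 := by
        rw [← Real.rpow_natCast (k : ℝ) 2, ← Real.rpow_add hk0]; congr 1; push_cast; ring
      rw [h4]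
      have h5 : 0 ≤ (c : ℝ) * (k : ℝ) ^ (-1 - ρ) := by positivity
      nlinarith [neg_abs_le T₁, abs_nonneg T₁]
    have hlim : Tendsto (fun k : ℕ => ENNReal.ofReal (2 * (c : ℝ) * (k : ℝ) ^ (-1 - ρ))) atTop (𝓝 0) := by
      have h1 : Tendsto (fun k : ℕ => ((k : ℝ)) ^ (-1 - ρ)) atTop (𝓝 0) := by
        have := (tendsto_rpow_neg_atTop (by linarith : 0 < 1 + ρ)).comp tendsto_natCast_atTop_atTop
        refine this.congr fun k => ?_
        simp only [Function.comp, neg_add']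
      have h2 := h1.const_mul (2 * (c : ℝ))
      rw [mul_zero] at h2
      have h3 := ENNReal.tendsto_ofReal h2
      rwa [ENNReal.ofReal_zero] at h3
    exact le_antisymm (le_of_tendsto_of_tendsto tendsto_const_nhds hlim hbd) bot_le
  -- `H τ₀ = 0` a.e., hence every good slice vanishes a.e.
  have hτ₀m : AEStronglyMeasurable (H τ₀) volume := by
    have := hτ₀.locallyIntegrableOn_deriv.aestronglyMeasurable
    rwa [Opens.coe_top, Measure.restrict_univ] at this
  have hG0 : H τ₀ =ᵐ[volume] 0 := slice_ae_zero_of_ballMass_zero hτ₀m hm0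
  have hslice0 : ∀ᵐ τ ∂(volume.restrict (Iio T₁)), H τ =ᵐ[volume] 0 := by
    filter_upwards [hrep] with τ hτ
    have h1 := (((Q τ₀).symm.trans (Q τ)).symm.measurePreserving).quasiMeasurePreserving.ae_eq hG0
    refine hτ.trans ?_
    filter_upwards [h1] with x hx
    simp only [Function.comp] at hx
    rw [hx, Pi.zero_apply, Pi.zero_apply]
    simp
  exact ae_eq_zero_of_weakGradient_slices_zero hρ hsw hH hc hT₁ hslice0

variable {P : ℝ} {L : EuclideanSpace ℝ (Fin 3) ≃ₗᵢ[ℝ] EuclideanSpace ℝ (Fin 3)}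

/-! ## (R1b) Relative periodic orbits: twisted-periodic past members are trivial -/

/-- **A.e. periodicity of the slice masses of a twisted-periodic past member**: if `u(τ) = L ∘ u(τ − P) ∘ L⁻¹` for `τ < T₁ ≤ 0` (`P > 0`), then for a.e.
`τ < T₁` and every radius `r`, `∫_{B_r}|H(τ)|²_F = ∫_{B_r}|H(τ − P)|²_F` (good slices at `τ` and `τ − P`, `ae_eq_conj_of_hasWeakFDerivOn`, `sliceMass_conj`),
and then `∫_{B_r}|H(τ − kP)|²_F = ∫_{B_r}|H(τ)|²_F` for every `k`. [folklore] -/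
theorem sliceMass_ae_periodic
    (hH : HasWeakSpatialGradientOn (slab (EuclideanSpace ℝ (Fin 3)) (Iio 0) isOpen_Iio) u H) (hT₁ : T₁ ≤ 0) (hP : 0 < P)
    (hu : ∀ τ : ℝ, τ < T₁ → u τ = fun x => L (u (τ - P) (L.symm x))) (k : ℕ) :
    ∀ᵐ τ ∂(volume : Measure ℝ), τ < T₁ → ∀ r : ℝ,
      ∫⁻ y in ball (0 : EuclideanSpace ℝ (Fin 3)) r, ENNReal.ofReal (frobeniusNormSq (H (τ - (k : ℝ) * P) y)) =
        ∫⁻ y in ball (0 : EuclideanSpace ℝ (Fin 3)) r, ENNReal.ofReal (frobeniusNormSq (H τ y)) := by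
  have hgood : ∀ᵐ τ ∂(volume : Measure ℝ), τ < T₁ → HasWeakFDerivOn (⊤ : Opens (EuclideanSpace ℝ (Fin 3))) volume (u τ) (H τ) :=
    (ae_restrict_iff' measurableSet_Iio).1 (FrameSteady.ae_hasWeakFDerivOn_slice_past hH hT₁)
  -- one step
  have hone : ∀ᵐ τ ∂(volume : Measure ℝ), τ < T₁ → ∀ r : ℝ,
      ∫⁻ y in ball (0 : EuclideanSpace ℝ (Fin 3)) r, ENNReal.ofReal (frobeniusNormSq (H τ y)) =
        ∫⁻ y in ball (0 : EuclideanSpace ℝ (Fin 3)) r, ENNReal.ofReal (frobeniusNormSq (H (τ - P) y)) := by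
    have h2 : ∀ᵐ τ ∂(volume : Measure ℝ), τ - P < T₁ → HasWeakFDerivOn (⊤ : Opens (EuclideanSpace ℝ (Fin 3))) volume (u (τ - P)) (H (τ - P)) :=
      (measurePreserving_sub_right volume P).quasiMeasurePreserving.ae hgood
    filter_upwards [hgood, h2] with τ hτ hτP hτT
    intro r
    have hrel := ae_eq_conj_of_hasWeakFDerivOn L (hτP (by linarith)) (hτ hτT) (hu τ hτT)
    have e : ∫⁻ y in ball (0 : EuclideanSpace ℝ (Fin 3)) r, ENNReal.ofReal (frobeniusNormSq (H τ y)) =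
        ∫⁻ y in ball (0 : EuclideanSpace ℝ (Fin 3)) r, ENNReal.ofReal (frobeniusNormSq ((L : EuclideanSpace ℝ (Fin 3) →L[ℝ] EuclideanSpace ℝ (Fin 3)).comp ((H (τ - P) (L.symm y)).comp ((L).symm : EuclideanSpace ℝ (Fin 3) →L[ℝ] EuclideanSpace ℝ (Fin 3))))) := by
      refine lintegral_congr_ae (ae_restrict_of_ae ?_)
      filter_upwards [hrel] with y hy
      rw [hy]
    rw [e, sliceMass_conj]
  induction k with
  | zero => exact Eventually.of_forall fun τ _ r => by simp
  | succ k ih =>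
    have ih' : ∀ᵐ τ ∂(volume : Measure ℝ), τ - P < T₁ → ∀ r : ℝ,
        ∫⁻ y in ball (0 : EuclideanSpace ℝ (Fin 3)) r, ENNReal.ofReal (frobeniusNormSq (H (τ - P - (k : ℝ) * P) y)) =
          ∫⁻ y in ball (0 : EuclideanSpace ℝ (Fin 3)) r, ENNReal.ofReal (frobeniusNormSq (H (τ - P) y)) :=
      (measurePreserving_sub_right volume P).quasiMeasurePreserving.ae ih
    filter_upwards [hone, ih'] with τ h1 h2 hτT
    intro r
    rw [show τ - ((k + 1 : ℕ) : ℝ) * P = τ - P - (k : ℝ) * P by push_cast; ring, h2 (by linarith) r, ← h1 hτT r]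

/-- **The period mass of a twisted-periodic past member vanishes** (`ρ > 0`): `∫_{(T₁−P, T₁)} ∫_{B_r} |H(τ)|²_F dτ = 0` for every `r` — `n` period windows
carry the same mass (`sliceMass_ae_periodic`), sit in `Q_a(0)` for `a = n(P + |T₁| + |r| + 1)`, and the `E`-gauge gives `n J ≤ c a^{1−ρ}`,
`J ≤ c S^{1−ρ} n^{−ρ} → 0`. [folklore] -/
theorem periodMass_eq_zero (hρ : 0 < ρ)
    (hH : HasWeakSpatialGradientOn (slab (EuclideanSpace ℝ (Fin 3)) (Iio 0) isOpen_Iio) u H)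
    (hE : ∀ a : ℝ, 0 < a → ENNReal.ofReal (a ^ ρ) * cknE a (0 : ℝ × EuclideanSpace ℝ (Fin 3)) H ≤ (c : ℝ≥0∞))
    (hT₁ : T₁ ≤ 0) (hP : 0 < P) (hu : ∀ τ : ℝ, τ < T₁ → u τ = fun x => L (u (τ - P) (L.symm x))) (r : ℝ) :
    ∫⁻ τ in Ioo (T₁ - P) T₁, ∫⁻ y in ball (0 : EuclideanSpace ℝ (Fin 3)) r, ENNReal.ofReal (frobeniusNormSq (H τ y)) = 0 := by
  set m : ℝ → ℝ → ℝ≥0∞ := fun r τ => ∫⁻ y in ball (0 : EuclideanSpace ℝ (Fin 3)) r, ENNReal.ofReal (frobeniusNormSq (H τ y)) with hm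
  set J : ℝ≥0∞ := ∫⁻ τ in Ioo (T₁ - P) T₁, m r τ with hJ
  set S : ℝ := P + |T₁| + |r| + 1 with hS
  have hS1 : 1 ≤ S := by rw [hS]; linarith [abs_nonneg r, abs_nonneg T₁, hP.le]
  have hS0 : 0 < S := by linarith
  -- every period window carries `J`
  have hwin : ∀ k : ℕ, ∫⁻ τ in Ioo (T₁ - ((k : ℝ) + 1) * P) (T₁ - (k : ℝ) * P), m r τ = J := by
    intro k
    have hmp := measurePreserving_sub_right (volume : Measure ℝ) ((k : ℝ) * P)
    have hme : MeasurableEmbedding fun τ : ℝ => τ - (k : ℝ) * P := (Homeomorph.subRight ((k : ℝ) * P)).measurableEmbedding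
    have h := hmp.setLIntegral_comp_preimage_emb hme (m r) (Ioo (T₁ - ((k : ℝ) + 1) * P) (T₁ - (k : ℝ) * P))
    have hpre : (fun τ : ℝ => τ - (k : ℝ) * P) ⁻¹' Ioo (T₁ - ((k : ℝ) + 1) * P) (T₁ - (k : ℝ) * P) = Ioo (T₁ - P) T₁ := by
      ext τ; simp only [mem_preimage, mem_Ioo]; constructor <;> rintro ⟨h1, h2⟩ <;> constructor <;> linarith
    rw [hpre] at h
    rw [← h, hJ]
    refine setLIntegral_congr_fun_ae measurableSet_Ioo ?_
    filter_upwards [sliceMass_ae_periodic hH hT₁ hP hu k] with τ hτ hτI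
    exact hτ hτI.2 r
  -- packing
  have key : ∀ n : ℕ, 1 ≤ n → J ≤ ENNReal.ofReal ((c : ℝ) * S ^ (1 - ρ) * (n : ℝ) ^ (-ρ)) := by
    intro n hn
    have hn1 : (1 : ℝ) ≤ n := by exact_mod_cast hn
    set a : ℝ := (n : ℝ) * S with ha
    have ha1 : 1 ≤ a := by rw [ha]; nlinarith
    have ha0 : 0 < a := by linarith
    set box : ℕ → Set ℝ := fun k => Ioo (T₁ - ((k : ℝ) + 1) * P) (T₁ - (k : ℝ) * P) with hbox
    have hdisj : Pairwise (Disjoint on box) := by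
      intro i j hij
      rcases lt_or_gt_of_ne hij with h | h
      · refine disjoint_left.2 fun τ h1 h2 => ?_
        have : ((i : ℝ) + 1) * P ≤ (j : ℝ) * P := mul_le_mul_of_nonneg_right (by exact_mod_cast h) hP.le
        rw [hbox] at h1 h2; simp only [mem_Ioo] at h1 h2; linarith [h1.1, h2.2]
      · refine disjoint_left.2 fun τ h1 h2 => ?_
        have : ((j : ℝ) + 1) * P ≤ (i : ℝ) * P := mul_le_mul_of_nonneg_right (by exact_mod_cast h) hP.le
        rw [hbox] at h1 h2; simp only [mem_Ioo] at h1 h2; linarith [h1.2, h2.1]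
    have hsub : (⋃ k ∈ Finset.range n, box k) ⊆ Ioo (T₁ - (n : ℝ) * P) T₁ := by
      intro τ hτ
      simp only [mem_iUnion, Finset.mem_range, exists_prop] at hτ
      obtain ⟨k, hk, hτ⟩ := hτ
      rw [hbox, mem_Ioo] at hτ
      have hk' : (k : ℝ) + 1 ≤ n := by exact_mod_cast hk
      have hk0 : (0 : ℝ) ≤ k := k.cast_nonneg
      exact ⟨by nlinarith [hτ.1], by nlinarith [hτ.2]⟩
    have h1 : (n : ℝ≥0∞) * J = ∫⁻ τ in ⋃ k ∈ Finset.range n, box k, m r τ := by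
      rw [lintegral_biUnion_finset (fun i _ j _ hij => hdisj hij) (fun k _ => measurableSet_Ioo),
        Finset.sum_congr rfl fun k _ => hwin k, Finset.sum_const, Finset.card_range, nsmul_eq_mul]
    -- the long window sits in `Q_a(0)` and `m r ≤ m a`
    have hra : r ≤ a := by
      have : |r| ≤ a := by rw [ha, hS]; nlinarith [abs_nonneg r, abs_nonneg T₁]
      exact (le_abs_self r).trans this
    have hlong : Ioo (T₁ - (n : ℝ) * P) T₁ ×ˢ ball (0 : EuclideanSpace ℝ (Fin 3)) a ⊆ Ioo (-(a ^ 2)) 0 ×ˢ ball (0 : EuclideanSpace ℝ (Fin 3)) a := by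
      refine Set.prod_mono (fun τ hτ => ⟨?_, lt_of_lt_of_le hτ.2 hT₁⟩) Subset.rfl
      have h2 : (n : ℝ) * P + |T₁| ≤ a := by rw [ha, hS]; nlinarith [abs_nonneg r, abs_nonneg T₁]
      have h3 : a ≤ a ^ 2 := by nlinarith
      linarith [hτ.1, neg_abs_le T₁]
    have hgauge := TimePeriodic.setLIntegral_window_le_of_gaugeE (H := H) (T := a ^ 2) ha0 le_rfl le_rfl (hE a ha0)
    have h3 : (n : ℝ≥0∞) * J ≤ ENNReal.ofReal ((c : ℝ) * a ^ (1 - ρ)) := by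
      rw [h1]
      calc ∫⁻ τ in ⋃ k ∈ Finset.range n, box k, m r τ ≤ ∫⁻ τ in Ioo (T₁ - (n : ℝ) * P) T₁, m r τ := lintegral_mono_set hsub
        _ ≤ ∫⁻ τ in Ioo (T₁ - (n : ℝ) * P) T₁, m a τ := lintegral_mono fun τ => lintegral_mono_set (ball_subset_ball hra)
        _ = ∫⁻ z in Ioo (T₁ - (n : ℝ) * P) T₁ ×ˢ ball (0 : EuclideanSpace ℝ (Fin 3)) a, ENNReal.ofReal (frobeniusNormSq (H z.1 z.2)) :=
            (setLIntegral_box_eq_iterate hH hT₁ a).symm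
        _ ≤ _ := (lintegral_mono_set hlong).trans hgauge
    have hn0 : (0 : ℝ) < n := by linarith
    have hn0' : (n : ℝ≥0∞) ≠ 0 := by exact_mod_cast (show (n : ℕ) ≠ 0 by exact_mod_cast hn0.ne')
    have h4 : J ≤ ENNReal.ofReal ((c : ℝ) * a ^ (1 - ρ)) / (n : ℝ≥0∞) := by
      rw [ENNReal.le_div_iff_mul_le (Or.inl hn0') (Or.inl (ENNReal.natCast_ne_top n)), mul_comm]
      exact h3
    refine h4.trans (le_of_eq ?_)
    rw [← ENNReal.ofReal_natCast, ← ENNReal.ofReal_div_of_pos hn0]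
    congr 1
    rw [ha, Real.mul_rpow hn0.le hS0.le, Real.rpow_sub hn0, Real.rpow_one, Real.rpow_neg hn0.le]
    field_simp
  have hlim : Tendsto (fun n : ℕ => ENNReal.ofReal ((c : ℝ) * S ^ (1 - ρ) * (n : ℝ) ^ (-ρ))) atTop (𝓝 0) := by
    have h1 : Tendsto (fun n : ℕ => ((n : ℝ)) ^ (-ρ)) atTop (𝓝 0) :=
      (tendsto_rpow_neg_atTop hρ).comp tendsto_natCast_atTop_atTop
    have h2 := h1.const_mul ((c : ℝ) * S ^ (1 - ρ))
    rw [mul_zero] at h2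
    have h3 := ENNReal.tendsto_ofReal h2
    rwa [ENNReal.ofReal_zero] at h3
  exact le_antisymm (le_of_tendsto_of_tendsto tendsto_const_nhds hlim ((eventually_ge_atTop 1).mono key)) bot_le

/-- **TWISTED-PERIODIC PAST MEMBERS ARE TRIVIAL** (`ρ > 0`; relative periodic orbits modulo `O(3)`): if `u(τ) = L ∘ u(τ − P) ∘ L⁻¹` for all `τ < T₁ ≤ 0`
(`P > 0`, ONE linear isometry `L`), then `u = 0` a.e. on the slab: the period masses vanish on every window `(T' − P, T')`, `T' = T₁ − jP/2` (`periodMass_eq_zero`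
at `T'`), these windows cover `(−∞, T₁)`, so a.e. slice of `H` below `T₁` has zero mass on every ball and vanishes; `ae_eq_zero_of_weakGradient_slices_zero`. [folklore] -/
theorem ae_eq_zero_of_gauge_of_pastTwistedPeriodic (hρ : 0 < ρ)
    (hsw : IsSuitableWeakSolutionOn (slab (EuclideanSpace ℝ (Fin 3)) (Iio 0) isOpen_Iio) 0 0 u p)
    (hH : HasWeakSpatialGradientOn (slab (EuclideanSpace ℝ (Fin 3)) (Iio 0) isOpen_Iio) u H)
    (hc : ∀ a : ℝ, 0 < a → ENNReal.ofReal (a ^ (2 * ρ)) * cknA a (0 : ℝ × EuclideanSpace ℝ (Fin 3)) u +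
        ENNReal.ofReal (a ^ ρ) * cknE a (0 : ℝ × EuclideanSpace ℝ (Fin 3)) H +
        ENNReal.ofReal (a ^ (2 * ρ)) * cknD a (0 : ℝ × EuclideanSpace ℝ (Fin 3)) p ≤ (c : ℝ≥0∞))
    (hT₁ : T₁ ≤ 0) (hP : 0 < P) (hu : ∀ τ : ℝ, τ < T₁ → u τ = fun x => L (u (τ - P) (L.symm x))) :
    uncurry u =ᵐ[volume.restrict (Iio (0 : ℝ) ×ˢ (univ : Set (EuclideanSpace ℝ (Fin 3))))] 0 := by
  have hE : ∀ a : ℝ, 0 < a → ENNReal.ofReal (a ^ ρ) * cknE a (0 : ℝ × EuclideanSpace ℝ (Fin 3)) H ≤ (c : ℝ≥0∞) :=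
    fun a ha => le_trans (le_trans le_add_self le_self_add) (hc a ha)
  set m : ℝ → ℝ → ℝ≥0∞ := fun r τ => ∫⁻ y in ball (0 : EuclideanSpace ℝ (Fin 3)) r, ENNReal.ofReal (frobeniusNormSq (H τ y)) with hm
  -- measurability of the slice masses below `0`
  have hmm : ∀ r : ℝ, ∀ {s t : ℝ}, t ≤ 0 → AEMeasurable (m r) (volume.restrict (Ioo s t)) := by
    intro r s t ht
    have h1 : AEStronglyMeasurable (uncurry H) (volume.restrict (Ioo s t ×ˢ ball (0 : EuclideanSpace ℝ (Fin 3)) r)) := by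
      have h0 := hH.locallyIntegrableOn_grad.aestronglyMeasurable
      rw [coe_slab] at h0
      exact h0.mono_set (Set.prod_mono (fun τ hτ => lt_of_lt_of_le hτ.2 ht) (subset_univ _))
    rw [Measure.volume_eq_prod, ← Measure.prod_restrict] at h1
    exact ((ENNReal.continuous_ofReal.comp LerayHopfProofs.continuous_frobeniusNormSq).comp_aestronglyMeasurable h1).aemeasurable.lintegral_prod_right'
  -- on every window `(T' − P, T')`, `T' = T₁ − j P/2`, the masses vanish a.e.
  have hwin : ∀ (j n : ℕ), ∀ᵐ τ ∂(volume.restrict (Ioo (T₁ - (j : ℝ) * (P / 2) - P) (T₁ - (j : ℝ) * (P / 2)))), m n τ = 0 := by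
    intro j n
    have hT' : T₁ - (j : ℝ) * (P / 2) ≤ 0 := by
      have : (0 : ℝ) ≤ (j : ℝ) * (P / 2) := by positivity
      linarith
    have hu' : ∀ τ : ℝ, τ < T₁ - (j : ℝ) * (P / 2) → u τ = fun x => L (u (τ - P) (L.symm x)) := fun τ hτ => hu τ (by
      have : (0 : ℝ) ≤ (j : ℝ) * (P / 2) := by positivity
      linarith)
    have h0 := periodMass_eq_zero (T₁ := T₁ - (j : ℝ) * (P / 2)) hρ hH hE hT' hP hu' n
    exact (lintegral_eq_zero_iff' (hmm n hT')).1 h0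
  -- the windows cover `(−∞, T₁)`
  have hcover : Iio T₁ ⊆ ⋃ j : ℕ, Ioo (T₁ - (j : ℝ) * (P / 2) - P) (T₁ - (j : ℝ) * (P / 2)) := by
    intro τ hτ
    have hx : 0 < 2 * (T₁ - τ) / P := div_pos (by linarith [mem_Iio.1 hτ]) hP
    set j : ℕ := Nat.ceil (2 * (T₁ - τ) / P) - 1 with hj
    have hj1 : 1 ≤ Nat.ceil (2 * (T₁ - τ) / P) := Nat.one_le_iff_ne_zero.2 (Nat.pos_iff_ne_zero.1 (Nat.ceil_pos.2 hx))
    have hjR : (j : ℝ) = (Nat.ceil (2 * (T₁ - τ) / P) : ℝ) - 1 := by rw [hj, Nat.cast_sub hj1, Nat.cast_one]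
    have hlt : (j : ℝ) < 2 * (T₁ - τ) / P := by rw [hjR]; linarith [Nat.ceil_lt_add_one hx.le]
    have hge : 2 * (T₁ - τ) / P - 1 ≤ (j : ℝ) := by rw [hjR]; linarith [Nat.le_ceil (2 * (T₁ - τ) / P)]
    refine mem_iUnion.2 ⟨j, ?_, ?_⟩
    · have h1 : (j : ℝ) * (P / 2) + P > T₁ - τ := by
        have := mul_le_mul_of_nonneg_right hge (by linarith : (0 : ℝ) ≤ P / 2)
        rw [sub_mul, div_mul_eq_mul_div, show 2 * (T₁ - τ) * (P / 2) = (T₁ - τ) * P by ring, mul_div_assoc, div_self hP.ne', mul_one] at this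
        linarith
      linarith
    · have h1 : (j : ℝ) * (P / 2) < T₁ - τ := by
        have := mul_lt_mul_of_pos_right hlt (by linarith : (0 : ℝ) < P / 2)
        rwa [div_mul_eq_mul_div, show 2 * (T₁ - τ) * (P / 2) = (T₁ - τ) * P by ring, mul_div_assoc, div_self hP.ne', mul_one] at this
      linarith
  have hall : ∀ᵐ τ ∂(volume.restrict (Iio T₁)), ∀ n : ℕ, m n τ = 0 := by
    refine ae_restrict_of_ae_restrict_of_subset hcover ?_
    rw [ae_restrict_iUnion_iff]
    intro j
    rw [ae_all_iff]
    exact fun n => hwin j n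
  -- hence a.e. slice below `T₁` vanishes
  have hgood := FrameSteady.ae_hasWeakFDerivOn_slice_past hH hT₁
  have hslice0 : ∀ᵐ τ ∂(volume.restrict (Iio T₁)), H τ =ᵐ[volume] 0 := by
    filter_upwards [hall, hgood] with τ hτ hτg
    have hτm : AEStronglyMeasurable (H τ) volume := by
      have := hτg.locallyIntegrableOn_deriv.aestronglyMeasurable
      rwa [Opens.coe_top, Measure.restrict_univ] at this
    exact slice_ae_zero_of_ballMass_zero hτm hτ
  exact ae_eq_zero_of_weakGradient_slices_zero hρ hsw hH hc hT₁ hslice0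

/-! ## (R1) The stratum, by name -/

/-- **THE TWISTED-CLOCK STRATUM, BY NAME** (`Sig.stub_twistedClock` of line `relative-equilibria` with the bodies of `InClass`, `IsPastTwistedSteady`,
`IsPastTwistedPeriodic`, `VanishesAE` verbatim; the binder `ρ ≤ 1/2` is idle — every `ρ > 0` works). [folklore] -/
theorem twistedClock_stratum :
    ∀ ρ : ℝ, 0 < ρ → ρ ≤ 1 / 2 → ∀ (u : ℝ → EuclideanSpace ℝ (Fin 3) → EuclideanSpace ℝ (Fin 3)) (p : ℝ → EuclideanSpace ℝ (Fin 3) → ℝ)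
      (H : ℝ → EuclideanSpace ℝ (Fin 3) → EuclideanSpace ℝ (Fin 3) →L[ℝ] EuclideanSpace ℝ (Fin 3)) (c : ℝ≥0),
      (IsSuitableWeakSolutionOn (slab (EuclideanSpace ℝ (Fin 3)) (Set.Iio 0) isOpen_Iio) 0 0 u p ∧
        HasWeakSpatialGradientOn (slab (EuclideanSpace ℝ (Fin 3)) (Set.Iio 0) isOpen_Iio) u H ∧
        (∀ a : ℝ, 0 < a →
          ENNReal.ofReal (a ^ (2 * ρ)) * cknA a (0 : ℝ × EuclideanSpace ℝ (Fin 3)) u +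
              ENNReal.ofReal (a ^ ρ) * cknE a (0 : ℝ × EuclideanSpace ℝ (Fin 3)) H +
            ENNReal.ofReal (a ^ (2 * ρ)) * cknD a (0 : ℝ × EuclideanSpace ℝ (Fin 3)) p ≤ (c : ℝ≥0∞))) →
      ((∃ (T₁ : ℝ) (v : EuclideanSpace ℝ (Fin 3) → EuclideanSpace ℝ (Fin 3))
          (Q : ℝ → (EuclideanSpace ℝ (Fin 3) ≃ₗᵢ[ℝ] EuclideanSpace ℝ (Fin 3))), T₁ ≤ 0 ∧
          ∀ τ : ℝ, τ < T₁ → u τ = fun x => Q τ (v ((Q τ).symm x))) ∨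
        (∃ (T₁ P : ℝ) (L : EuclideanSpace ℝ (Fin 3) ≃ₗᵢ[ℝ] EuclideanSpace ℝ (Fin 3)), T₁ ≤ 0 ∧ 0 < P ∧
          ∀ τ : ℝ, τ < T₁ → u τ = fun x => L (u (τ - P) (L.symm x)))) →
      Function.uncurry u =ᵐ[volume.restrict (Set.Iio (0 : ℝ) ×ˢ (Set.univ : Set (EuclideanSpace ℝ (Fin 3))))] 0 := by
  intro ρ hρ _ u p H c hcls htw
  obtain ⟨hsw, hH, hc⟩ := hcls
  rcases htw with ⟨T₁, v, Q, hT₁, hu⟩ | ⟨T₁, P, L, hT₁, hP, hu⟩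
  · exact ae_eq_zero_of_gauge_of_pastTwistedSteady hρ hsw hH hc hT₁ hu
  · exact ae_eq_zero_of_gauge_of_pastTwistedPeriodic hρ hsw hH hc hT₁ hP hu

end Twisted

end Summit.NavierStokesRegularity.NavierStokesRegularity.Theorems.PowerGaugeEulerLiouville
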